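import Literature.AlgebraicGeometry.Resolution.HenselLift
import Literature.AlgebraicGeometry.Resolution.SeparableClosureValuation
import Mathlib.RingTheory.Valuation.Integral
import HarnessLib

/-!
# Reduction of integral polynomials and residues of their roots; Hensel lifts with their reduction

Topic: `Literature/AlgebraicGeometry/Resolution` (valued function fields). PROVED [folklore]
bookkeeping for the proof of Kuhlmann 2010 (*Elimination of ramification I*, Trans. AMS 362
(2010) = arXiv:1003.5678), Prop. 2.18 and of the Lemma of Ostrowski in the ambient rendering of
`HenselizedFunctionFields*.lean` (one algebraically closed valued field `(Ω, V)`, fields as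
subfields of `Ω`, residue fields as subfields `Mv = residueSubfield M V ⊆ Ωv`): for a MONIC
polynomial `P ∈ V[X]` over the (big) valuation ring,

* its roots in `Ω` lie in `V` (`mem_of_isRoot_map_of_monic`), so `P = ∏_{b ∈ T} (X - b)` in
  `V[X]` for a multiset `T ⊆ V` lifting the roots (`exists_multiset_prod_X_sub_C_eq`), and the
  reduction `P̄ = ∏ (X - b̄)` has as roots exactly the residues of the roots of `P`, counted with
  multiplicity (`map_residue_eq_prod`);
* `exists_lift_root_of_henselianLocalRing` — the Hensel lift of §2.5, p. 9 ("Take a monic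
  polynomial `f` with coefficients in the valuation ring of `K(x)` and such that `f̄` is the
  minimal polynomial of `ζ` … By Hensel's Lemma, `f` has a root `y ∈ F` such that `ȳ = ζ`") in
  the form of `exists_root_lift_of_henselianLocalRing` (`HenselLift.lean`) but RECORDING THE
  REDUCTION `ḡ₀ = φ` of the lifted polynomial, which is what makes the residues of the other
  roots of `g₀` roots of `φ` (and distinct when `φ` is separable).

## Sources

* F.-V. Kuhlmann, Trans. AMS 362 (2010) = arXiv:1003.5678, §2.5 (p. 9). [folklore] otherwise.
-/

noncomputable section

open IsLocalRing Polynomial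

namespace Literature.AlgebraicGeometry.Resolution

universe u

variable {Ω : Type u} [Field Ω] (V : ValuationSubring Ω)

/-! ### Integral polynomials: roots and reduction -/

section Reduction

/-- `V` is a ring of integers of its own valuation (Mathlib's `Valuation.Integers`). [folklore] -/
theorem integers_valuationSubring : V.valuation.Integers V :=
  ⟨Subtype.val_injective, fun x => V.valuation_le_one x,
    fun r hr => ⟨⟨r, (V.valuation_le_one_iff r).mp hr⟩, rfl⟩⟩

/-- **Roots of monic integral polynomials are integral**: a root in `Ω` of a monic `P ∈ V[X]`
lies in `V` (valuation rings are integrally closed). [folklore] -/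
theorem mem_of_isRoot_map_of_monic {P : V[X]} (hP : P.Monic) {β : Ω}
    (hβ : (P.map (algebraMap V Ω)).IsRoot β) : β ∈ V := by
  have hi : IsIntegral V β := ⟨P, hP, by rwa [Polynomial.IsRoot.def, Polynomial.eval_map] at hβ⟩
  exact (V.valuation_le_one_iff β).mp ((integers_valuationSubring V).isIntegral_iff_v_le_one.mp hi)

variable [IsAlgClosed Ω]

/-- **A monic integral polynomial factors over `V` into linear factors**: for `P ∈ V[X]` monic
(and `Ω` algebraically closed) there is a multiset `T` of elements of `V` with
`P = ∏_{b ∈ T} (X - b)` in `V[X]`, lifting the multiset of roots of `P` in `Ω`. [folklore] -/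
theorem exists_multiset_prod_X_sub_C_eq {P : V[X]} (hP : P.Monic) :
    ∃ T : Multiset V, P = (T.map fun b => X - C b).prod ∧
      T.map (fun b : V => (b : Ω)) = (P.map (algebraMap V Ω)).roots := by
  classical
  set PΩ : Polynomial Ω := P.map (algebraMap V Ω) with hPΩ
  have hmon : PΩ.Monic := hP.map _
  have hsplit : PΩ.Splits := IsAlgClosed.splits PΩ
  have hroots : ∀ β ∈ PΩ.roots, β ∈ V := fun β hβ =>
    mem_of_isRoot_map_of_monic V hP ((Polynomial.mem_roots hmon.ne_zero).mp hβ)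
  -- lift the roots into `V`
  obtain ⟨T, hT⟩ : ∃ T : Multiset V, T.map (fun b : V => (b : Ω)) = PΩ.roots :=
    ⟨PΩ.roots.attach.map fun x => ⟨x.1, hroots x.1 x.2⟩, by
      rw [Multiset.map_map]
      exact Multiset.attach_map_val _⟩
  refine ⟨T, ?_, hT⟩
  apply Polynomial.map_injective (algebraMap V Ω) Subtype.val_injective
  rw [Polynomial.map_multiset_prod, Multiset.map_map]
  have h1 : (T.map ((Polynomial.map (algebraMap V Ω)) ∘ fun b : V => X - C b)) =
      (T.map (fun b : V => (b : Ω))).map (fun β : Ω => X - C β) := by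
    rw [Multiset.map_map]
    refine Multiset.map_congr rfl fun b _ => ?_
    simp
  rw [h1, hT]
  exact hsplit.eq_prod_roots_of_monic hmon

omit [IsAlgClosed Ω] in
/-- **Residues of the roots are the roots of the reduction**: with `T` as above,
`P̄ = ∏_{b ∈ T} (X - b̄)` and the roots of `P̄` in `Ωv` are the residues of the elements of `T`.
[folklore] -/
theorem map_residue_eq_prod {P : V[X]} {T : Multiset V}
    (hT : P = (T.map fun b => X - C b).prod) :
    P.map (residue V) = (T.map fun b => X - C (residue V b)).prod ∧
      (P.map (residue V)).roots = T.map (residue V) := by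
  have h : P.map (residue V) = (T.map fun b => X - C (residue V b)).prod := by
    rw [hT, Polynomial.map_multiset_prod, Multiset.map_map]
    congr 1
    refine Multiset.map_congr rfl fun b _ => ?_
    simp
  refine ⟨h, ?_⟩
  rw [h]
  have : (T.map fun b => X - C (residue V b)) = (T.map (residue V)).map (fun r => X - C r) := by
    rw [Multiset.map_map]
    rfl
  rw [this, Polynomial.roots_multiset_prod_X_sub_C]

end Reduction

/-! ### Lifting a simple residue root, with the reduction recorded -/

section Lift

/-- **Hensel lift of a separable residue root, with its reduction** (Kuhlmann 2010, §2.5, p. 9: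
"Take a monic polynomial `f` with coefficients in the valuation ring of `K(x)` and such that `f̄`
is the minimal polynomial of `ζ` … By Hensel's Lemma, `f` has a root `y ∈ F` such that
`ȳ = ζ`. Since `deg(f) = deg(f̄)` …"): inside `(Ω, V)`, for subfields `F ≤ N` with `V ∩ N` a
henselian local ring, a monic irreducible `φ` over the residue field `Fv ⊆ Ωv` and a simple root
`ζ ∈ Nv` of `φ`, there are a monic `g₀ ∈ (V ∩ F)[X]` REDUCING TO `φ` (so `deg g₀ = deg φ`),
irreducible over `F` (Gauss's lemma for the integrally closed `V ∩ F`), and a root `y ∈ V ∩ N`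
of `g₀` with residue `ζ`. A variant of `exists_root_lift_of_henselianLocalRing` (`HenselLift.lean`)
recording the reduction `ḡ₀ = φ`, which the proof of Prop. 2.18 consumes. PROVED.
[cite: Kuhlmann2010, Section 2.5 (p. 9)] -/
theorem exists_lift_root_of_henselianLocalRing {F N : Subfield Ω} (hle : F ≤ N)
    (hN : HenselianLocalRing (V.comap (algebraMap N Ω)))
    (φ : Polynomial (residueSubfield F V)) (hmon : φ.Monic) (hirr : Irreducible φ)
    {ζ : ResidueField V} (hζN : ζ ∈ residueSubfield N V) (hroot : aeval ζ φ = 0)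
    (hsimple : aeval ζ (derivative φ) ≠ 0) :
    ∃ (g₀ : Polynomial (V.comap (algebraMap F Ω))) (y : Ω) (hyV : y ∈ V),
      g₀.Monic ∧ g₀.natDegree = φ.natDegree ∧
      g₀.map (residueHom V F) = φ.map (algebraMap (residueSubfield F V) (ResidueField V)) ∧
      Irreducible (g₀.map (algebraMap (V.comap (algebraMap F Ω)) F)) ∧
      y ∈ N ∧
      ((g₀.map (algebraMap (V.comap (algebraMap F Ω)) F)).map (algebraMap F Ω)).IsRoot y ∧
      residue V ⟨y, hyV⟩ = ζ := by
  classical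
  haveI := hN
  set O : ValuationSubring F := V.comap (algebraMap F Ω) with hO
  set ON : ValuationSubring N := V.comap (algebraMap N Ω) with hON
  -- the residue map `O → k = Fv`, onto
  let θk : O →+* residueSubfield F V :=
    (residueHom V F).codRestrict (residueSubfield F V) (residueHom_mem V F)
  have hθk : Function.Surjective θk := by
    rintro ⟨r, hr⟩
    obtain ⟨c, hc, hcr⟩ := (mem_residueSubfield_iff F V r).mp hr
    exact ⟨⟨c, hc⟩, Subtype.ext hcr⟩
  have hθk_comp : (algebraMap (residueSubfield F V) (ResidueField V)).comp θk = residueHom V F :=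
    RingHom.ext fun _ => rfl
  -- lift `φ` to a monic `g₀` over `O`
  obtain ⟨g₀, hg₀, hdeg, hmon₀⟩ := lifts_and_natDegree_eq_and_monic
    ((mem_lifts φ).mpr (map_surjective θk hθk φ)) hmon
  have hirr₀ : Irreducible g₀ :=
    Monic.irreducible_of_irreducible_map θk g₀ hmon₀ (by rw [hg₀]; exact hirr)
  haveI : IsIntegrallyClosed O := isIntegrallyClosed_comap V F
  have hirrg : Irreducible (g₀.map (algebraMap O F)) :=
    (hmon₀.irreducible_iff_irreducible_map_fraction_map).mp hirr₀
  have hmapθ : g₀.map (residueHom V F) =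
      φ.map (algebraMap (residueSubfield F V) (ResidueField V)) := by
    rw [← hg₀, Polynomial.map_map, hθk_comp]
  -- move to `ON = V ∩ N` and apply Hensel's Lemma there
  let ι : O →+* ON :=
    { toFun := fun c => ⟨⟨((c : F) : Ω), hle (c : F).2⟩, c.2⟩
      map_one' := rfl
      map_mul' := fun _ _ => rfl
      map_zero' := rfl
      map_add' := fun _ _ => rfl }
  have hθι : (residueHom V N).comp ι = residueHom V F := RingHom.ext fun _ => rfl
  obtain ⟨e, he, heζ⟩ := (mem_residueSubfield_iff N V ζ).mp hζN
  set a₀ : ON := ⟨e, he⟩ with ha₀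
  have hθa₀ : residueHom V N a₀ = ζ := heζ
  have heval : ∀ q : Polynomial O,
      residueHom V N ((q.map ι).eval a₀) = (q.map (residueHom V F)).eval ζ := fun q => by
    rw [← Polynomial.eval₂_at_apply, ← Polynomial.eval_map, Polynomial.map_map, hθι, hθa₀]
  set gN : Polynomial ON := g₀.map ι with hgN
  have h1 : gN.eval a₀ ∈ maximalIdeal ON := by
    rw [← residueHom_eq_zero_iff, hgN, heval, hmapθ, Polynomial.eval_map_algebraMap]
    exact hroot
  have h2 : IsUnit (gN.derivative.eval a₀) := by
    by_contra hnu
    have hmem : gN.derivative.eval a₀ ∈ maximalIdeal ON := (IsLocalRing.mem_maximalIdeal _).mpr hnu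
    rw [← residueHom_eq_zero_iff, hgN, Polynomial.derivative_map, heval,
      ← Polynomial.derivative_map, hmapθ, Polynomial.derivative_map,
      Polynomial.eval_map_algebraMap] at hmem
    exact hsimple hmem
  obtain ⟨y₀, hy₀, hy₀a⟩ := HenselianLocalRing.is_henselian gN (hmon₀.map ι) a₀ h1 h2
  refine ⟨g₀, ((y₀ : N) : Ω), y₀.2, hmon₀, hdeg, hmapθ, hirrg, (y₀ : N).2, ?_, ?_⟩
  · -- `g₀(y) = 0`
    have h3 : ((algebraMap N Ω).comp (algebraMap ON N)) (gN.eval y₀) = 0 := by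
      rw [hy₀.eq_zero, map_zero]
    rw [← Polynomial.eval₂_at_apply, hgN, Polynomial.eval₂_map] at h3
    rw [Polynomial.IsRoot.def, Polynomial.eval_map, Polynomial.eval₂_map]
    exact h3
  · -- residue of `y` is `ζ`
    have h4 : residueHom V N (y₀ - a₀) = 0 := (residueHom_eq_zero_iff V N _).mpr hy₀a
    rw [map_sub, sub_eq_zero, hθa₀] at h4
    exact h4

end Lift

end Literature.AlgebraicGeometry.Resolution
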